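import Summits.CriticalPhenomena.PercolationContinuityZ3.Theorems.PercNearOneGluingNoHeavyLowerTailCovarianceGluing
import Summits.CriticalPhenomena.PercolationContinuityZ3.Theorems.PercNearOneGluingNoHeavyLowerTailOwnConnection
import HarnessLib

/-!
# `NoHeavyLowerTail` (stmt-CriticalPhenomena-4575) — COVARIANCE GLUING (U) holds for `|A| ≤ 2`

Support file (prover prim-gen-kcluster gen 4; `--supports stmt-CriticalPhenomena-4575`).  No definitions, no named facts, no sorries.

`covGluing_card_le_two`: the hypothesis `hU` of `CovarianceGluing.eventGluing_of_covGluing` (registered stub `stub_covGluing`),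
`Σ_{a∈A} μ(V_a)·μ(a ↔ c) ≤ μ({o ↔ c} ∩ ⋃_{a∈A}{o ↔ a})`, holds for every relay set with at most two elements.
For `A = {x, y}` with `x` ranked first (`d_x > d_y`, or `d_x = d_y` and `x < y`) one has `V_x = {o ↔ x}`, `V_y = {o ↔ y} ∖ {o ↔ x}`, and

  `Σ_a Cov(1_{V_a}, 1_{a↔c}) = [Cov(1{o↔x}, 1{x↔c}) − Cov(1{o↔x}, 1{y↔c})] + Cov(1{o↔x ∨ o↔y}, 1{y↔c}) ≥ 0`

by "own connection helps most" (`OwnConnection.ownConnection_cov_le`, landed) and Harris.  (`|A| = 1` is Harris, `|A| = 0` is trivial.)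
-/

noncomputable section

namespace Summit.CriticalPhenomena.PercolationContinuityZ3.Theorems

open MeasureTheory Set Literature.Probability.LatticeModels Literature.Probability.Percolation
open scoped Classical BigOperators

namespace CovarianceGluing

variable {n : ℕ}

/-- The ordered-pair case: `x ≠ y`, `x` ranked first. [this file] -/
theorem covGluing_pair (w : Sym2 (Fin n) → unitInterval) (o c x y : Fin n) (hne : x ≠ y)
    (hprec : (prodBernoulli w).real (openConn y c : Set (BondConfig (Fin n)))ᶜ <
        (prodBernoulli w).real (openConn x c : Set (BondConfig (Fin n)))ᶜ ∨
      ((prodBernoulli w).real (openConn y c : Set (BondConfig (Fin n)))ᶜ =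
        (prodBernoulli w).real (openConn x c : Set (BondConfig (Fin n)))ᶜ ∧ x ≤ y)) :
    ∑ a ∈ ({x, y} : Finset (Fin n)), (prodBernoulli w).real
          {ω : BondConfig (Fin n) | (openGraph ω).Reachable o a ∧
            ∀ z ∈ ({x, y} : Finset (Fin n)), (openGraph ω).Reachable o z →
              ((prodBernoulli w).real (openConn z c : Set (BondConfig (Fin n)))ᶜ <
                  (prodBernoulli w).real (openConn a c : Set (BondConfig (Fin n)))ᶜ ∨
               ((prodBernoulli w).real (openConn z c : Set (BondConfig (Fin n)))ᶜ =
                  (prodBernoulli w).real (openConn a c : Set (BondConfig (Fin n)))ᶜ ∧ a ≤ z))} *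
        (prodBernoulli w).real (openConn a c : Set (BondConfig (Fin n))) ≤
      (prodBernoulli w).real ((openConn o c : Set (BondConfig (Fin n))) ∩ ⋃ a ∈ ({x, y} : Finset (Fin n)), openConn o a) := by
  set μ := prodBernoulli w with hμ
  set r : Fin n → ℝ := fun z => μ.real (openConn z c : Set (BondConfig (Fin n)))ᶜ with hr
  have hyx : ¬ (r x < r y ∨ (r x = r y ∧ y ≤ x)) := by
    simp only [hr]
    rintro (h | ⟨h1, h2⟩)
    · rcases hprec with h' | ⟨h1', _⟩
      · exact absurd (lt_trans h h') (lt_irrefl _)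
      · rw [h1'] at h; exact absurd h (lt_irrefl _)
    · rcases hprec with h' | ⟨_, h2'⟩
      · rw [h1] at h'; exact absurd h' (lt_irrefl _)
      · exact hne (le_antisymm h2' h2)
  -- identify the two rank events
  have hVx : {ω : BondConfig (Fin n) | (openGraph ω).Reachable o x ∧
            ∀ z ∈ ({x, y} : Finset (Fin n)), (openGraph ω).Reachable o z →
              (r z < r x ∨ (r z = r x ∧ x ≤ z))} = (openConn o x : Set (BondConfig (Fin n))) := by
    ext ω
    simp only [mem_setOf_eq, openConn, Finset.mem_insert, Finset.mem_singleton]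
    constructor
    · rintro ⟨h, _⟩; exact h
    · intro h
      refine ⟨h, ?_⟩
      rintro z (rfl | rfl) _
      · exact Or.inr ⟨rfl, le_refl _⟩
      · exact hprec
  have hVy : {ω : BondConfig (Fin n) | (openGraph ω).Reachable o y ∧
            ∀ z ∈ ({x, y} : Finset (Fin n)), (openGraph ω).Reachable o z →
              (r z < r y ∨ (r z = r y ∧ y ≤ z))} =
        (openConn o y : Set (BondConfig (Fin n))) ∩ (openConn o x)ᶜ := by
    ext ω
    simp only [mem_setOf_eq, openConn, mem_inter_iff, mem_compl_iff, Finset.mem_insert, Finset.mem_singleton]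
    constructor
    · rintro ⟨hoy, hall⟩
      exact ⟨hoy, fun hox => hyx (hall x (Or.inl rfl) hox)⟩
    · rintro ⟨hoy, hox⟩
      refine ⟨hoy, ?_⟩
      rintro z (rfl | rfl) hz
      · exact absurd hz hox
      · exact Or.inr ⟨rfl, le_refl _⟩
  rw [through_eq_sum_rankJ w {x, y} o c r]
  rw [Finset.sum_pair hne, Finset.sum_pair hne]
  simp only [hr] at hVx hVy
  rw [hVx, hVy]
  -- the pieces
  have hV1 := OwnConnection.ownConnection_cov_le w o x y c (by
    rcases hprec with h | ⟨h, _⟩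
    · exact le_of_lt h
    · exact le_of_eq h)
  have hU : IsUpperSet ((openConn o x : Set (BondConfig (Fin n))) ∪ openConn o y) :=
    (isUpperSet_openConn o x).union (isUpperSet_openConn o y)
  have hH := prodBernoulli_harris_via_fibres w hU (isUpperSet_openConn y c)
  -- bookkeeping: {o↔y} ∖ {o↔x} = ({o↔x} ∪ {o↔y}) ∖ {o↔x}
  have e1 : μ.real ((openConn o y : Set (BondConfig (Fin n))) ∩ (openConn o x)ᶜ) =
      μ.real ((openConn o x : Set (BondConfig (Fin n))) ∪ openConn o y) - μ.real (openConn o x : Set (BondConfig (Fin n))) := by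
    have hs : ((openConn o y : Set (BondConfig (Fin n))) ∩ (openConn o x)ᶜ) =
        (((openConn o x : Set (BondConfig (Fin n))) ∪ openConn o y) \ openConn o x) := by
      ext ω; simp only [mem_inter_iff, mem_compl_iff, mem_sdiff, mem_union]; tauto
    have hsub0 : (openConn o x : Set (BondConfig (Fin n))) ⊆ (openConn o x : Set (BondConfig (Fin n))) ∪ openConn o y :=
      Set.subset_union_left
    rw [hs, measureReal_sdiff hsub0 MeasurableSet.of_discrete]
  have e2 : μ.real ((openConn o y : Set (BondConfig (Fin n))) ∩ (openConn o x)ᶜ ∩ openConn y c) =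
      μ.real (((openConn o x : Set (BondConfig (Fin n))) ∪ openConn o y) ∩ openConn y c) -
        μ.real ((openConn o x : Set (BondConfig (Fin n))) ∩ openConn y c) := by
    have hs : ((openConn o y : Set (BondConfig (Fin n))) ∩ (openConn o x)ᶜ ∩ openConn y c) =
        ((((openConn o x : Set (BondConfig (Fin n))) ∪ openConn o y) ∩ openConn y c) \
          ((openConn o x : Set (BondConfig (Fin n))) ∩ openConn y c)) := by
      ext ω; simp only [mem_inter_iff, mem_compl_iff, mem_sdiff, mem_union]; tauto
    have hsub : ((openConn o x : Set (BondConfig (Fin n))) ∩ openConn y c) ⊆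
        (((openConn o x : Set (BondConfig (Fin n))) ∪ openConn o y) ∩ openConn y c) :=
      Set.inter_subset_inter_left _ Set.subset_union_left
    rw [hs, measureReal_sdiff hsub MeasurableSet.of_discrete]
  rw [e1, e2]
  nlinarith [hV1, hH]

/-- **(U) for `|A| ≤ 2` (PROVED)**: the hypothesis of `eventGluing_of_covGluing` (stub `stub_covGluing`) on every relay set with at most
two elements. [this file] -/
theorem covGluing_card_le_two (w : Sym2 (Fin n) → unitInterval) (A : Finset (Fin n)) (o c : Fin n) (hA : A.card ≤ 2) :
    ∑ a ∈ A, (prodBernoulli w).real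
          {ω : BondConfig (Fin n) | (openGraph ω).Reachable o a ∧
            ∀ z ∈ A, (openGraph ω).Reachable o z →
              ((prodBernoulli w).real (openConn z c : Set (BondConfig (Fin n)))ᶜ <
                  (prodBernoulli w).real (openConn a c : Set (BondConfig (Fin n)))ᶜ ∨
               ((prodBernoulli w).real (openConn z c : Set (BondConfig (Fin n)))ᶜ =
                  (prodBernoulli w).real (openConn a c : Set (BondConfig (Fin n)))ᶜ ∧ a ≤ z))} *
        (prodBernoulli w).real (openConn a c : Set (BondConfig (Fin n))) ≤
      (prodBernoulli w).real ((openConn o c : Set (BondConfig (Fin n))) ∩ ⋃ a ∈ A, openConn o a) := by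
  set μ := prodBernoulli w with hμ
  set r : Fin n → ℝ := fun z => μ.real (openConn z c : Set (BondConfig (Fin n)))ᶜ with hr
  interval_cases h : A.card
  · rw [Finset.card_eq_zero.1 h]
    simp only [Finset.sum_empty]
    exact measureReal_nonneg
  · obtain ⟨a, rfl⟩ := Finset.card_eq_one.1 h
    rw [Finset.sum_singleton]
    have hV : {ω : BondConfig (Fin n) | (openGraph ω).Reachable o a ∧
            ∀ z ∈ ({a} : Finset (Fin n)), (openGraph ω).Reachable o z →
              (r z < r a ∨ (r z = r a ∧ a ≤ z))} = (openConn o a : Set (BondConfig (Fin n))) := by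
      ext ω
      simp only [mem_setOf_eq, openConn, Finset.mem_singleton]
      constructor
      · rintro ⟨h, _⟩; exact h
      · intro h'
        refine ⟨h', ?_⟩
        rintro z rfl _
        exact Or.inr ⟨rfl, le_refl _⟩
    simp only [hr] at hV
    rw [hV]
    have hU : (⋃ z ∈ ({a} : Finset (Fin n)), (openConn o z : Set (BondConfig (Fin n)))) = openConn o a := by
      ext ω; simp only [Finset.mem_singleton, mem_iUnion, exists_prop, exists_eq_left]
    rw [hU]
    exact covGluing_singleton w o c a
  · obtain ⟨x, y, hne, rfl⟩ := Finset.card_eq_two.1 h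
    rcases lt_trichotomy (r y) (r x) with hlt | heq | hgt
    · exact covGluing_pair w o c x y hne (Or.inl hlt)
    · rcases lt_or_gt_of_ne hne with hxy | hyx
      · exact covGluing_pair w o c x y hne (Or.inr ⟨heq, le_of_lt hxy⟩)
      · rw [Finset.pair_comm]
        exact covGluing_pair w o c y x hne.symm (Or.inr ⟨heq.symm, le_of_lt hyx⟩)
    · rw [Finset.pair_comm]
      exact covGluing_pair w o c y x hne.symm (Or.inl hgt)

/-- **Calibration: covariance gluing (U) ⇒ Kozma–Nitzan's Conjecture 1 (post-FKG)** `P(o ↔ b) ≥ P(o ↔ A) · min_a P(a ↔ b)`, in the tree's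
form `(∀ a ∈ A, t ≤ μ(a ↔ b)) → μ(o ↔ A) · t ≤ μ(o ↔ b)`: `μ(o ↔ A)·t = Σ_a μ(V_a)·t ≤ Σ_a μ(V_a) μ(a ↔ b) ≤ μ({o ↔ b} ∩ {o ↔ A})`.
So (U) is at least as strong as KN's open Conjecture 1 (cf. `Theorems.WorstRelayGluing.kozmaNitzan_conjecture1_of_worstRelayGluing`,
`Theorems.kozmaNitzan_conjecture1_of_topWeighted`). [cite: KozmaNitzan2024, Conjecture 1 (p. 3)] -/
theorem kozmaNitzan_conjecture1_of_covGluing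
    (hU : ∀ (n : ℕ) (w : Sym2 (Fin n) → unitInterval) (A : Finset (Fin n)) (o c : Fin n),
      ∑ a ∈ A, (prodBernoulli w).real
          {ω : BondConfig (Fin n) | (openGraph ω).Reachable o a ∧
            ∀ x ∈ A, (openGraph ω).Reachable o x →
              ((prodBernoulli w).real (openConn x c : Set (BondConfig (Fin n)))ᶜ <
                  (prodBernoulli w).real (openConn a c : Set (BondConfig (Fin n)))ᶜ ∨
               ((prodBernoulli w).real (openConn x c : Set (BondConfig (Fin n)))ᶜ =
                  (prodBernoulli w).real (openConn a c : Set (BondConfig (Fin n)))ᶜ ∧ a ≤ x))} *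
        (prodBernoulli w).real (openConn a c : Set (BondConfig (Fin n))) ≤
      (prodBernoulli w).real ((openConn o c : Set (BondConfig (Fin n))) ∩ ⋃ a ∈ A, openConn o a)) :
    ∀ (n : ℕ) (w : Sym2 (Fin n) → unitInterval) (A : Finset (Fin n)) (o b : Fin n) (t : ℝ),
      (∀ a ∈ A, t ≤ (prodBernoulli w).real (openConn a b)) →
        (prodBernoulli w).real (⋃ a ∈ A, openConn o a) * t ≤ (prodBernoulli w).real (openConn o b) := by
  intro n w A o b t ht
  set μ := prodBernoulli w with hμ
  set r : Fin n → ℝ := fun x => μ.real (openConn x b : Set (BondConfig (Fin n)))ᶜ with hr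
  have h := hU n w A o b
  rw [reach_eq_sum_rankJ w A o r, Finset.sum_mul]
  calc ∑ a ∈ A, μ.real {ω : BondConfig (Fin n) | (openGraph ω).Reachable o a ∧
            ∀ x ∈ A, (openGraph ω).Reachable o x → (r x < r a ∨ (r x = r a ∧ a ≤ x))} * t
      ≤ ∑ a ∈ A, μ.real {ω : BondConfig (Fin n) | (openGraph ω).Reachable o a ∧
            ∀ x ∈ A, (openGraph ω).Reachable o x → (r x < r a ∨ (r x = r a ∧ a ≤ x))} *
          μ.real (openConn a b : Set (BondConfig (Fin n))) := by
        refine Finset.sum_le_sum fun a ha => ?_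
        exact mul_le_mul_of_nonneg_left (ht a ha) measureReal_nonneg
    _ ≤ μ.real ((openConn o b : Set (BondConfig (Fin n))) ∩ ⋃ a ∈ A, openConn o a) := h
    _ ≤ μ.real (openConn o b : Set (BondConfig (Fin n))) := measureReal_mono inter_subset_left

end CovarianceGluing

end Summit.CriticalPhenomena.PercolationContinuityZ3.Theorems

end
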